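import Summits.HodgeConjecture.HodgeConjecture.Theorems.NikulinTwinTransportSectorComplement
import Literature.AlgebraicGeometry.HodgeTheory.MiddleDimensionReductionHolds
import Literature.AlgebraicGeometry.HodgeTheory.MotivatedClassesAlgebraic
import Literature.AlgebraicGeometry.HodgeTheory.MotivatedClassesTransport
import Literature.AlgebraicGeometry.HodgeTheory.HardLefschetzNFoldHolds
import Literature.AlgebraicGeometry.HodgeTheory.HodgeLocus

/-!
# Strategy census, generation 1 / wall-breaker pass p1 — typed objects
# for `NikulinTwinTransport.SectorComplement` (crux stmt-HodgeConjecture-13684)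

Crux-strategist seat `planner-cstrat-stmt-HodgeConjecture-13684-p1-0` (wall-breaker pass), 2026-08-17.
Companion of the `# Part p1` addendum of `Cruxes/SectorComplement/STRATEGY-CENSUS.md` (same seat). Generation 0's companion
(`StrategyCensus13684.lean`, seat `…-13684-0`) typed the degree split, the André seam MODULO the
named fact `Andre1996_motivatedClasses_le_algebraicClasses_of_standardConjectureB`, the
strengthening law, the motivated / `ℚ̄` summits and the negation shape; the landed truth table
(p84060, `Theorems/NikulinTwinTransportSectorComplement.lean`) is cited by both and re-proved by
neither. This file adds ONLY the typed objects of this pass (the parallel gen-1 seat `…-13684-s1-0` has its own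
companion `StrategyCensus13684s1.lean`: cone-inertia laws, six wiring certificates, diagonal transfer):

* §D2′ the FACT-FREE André seam — `MotivatedAlgebraicAll → HodgeIsMotivatedAll → SectorComplement`
  with a sorry-free, hypothesis-free glue over the real carriers (`sectorComplement_of_subs`): the
  exact theorem a `route edit --split SectorComplement --into MotivatedAlgebraicAll
  HodgeIsMotivatedAll --glue …` would cite. Recorded FILEABLE; the census explains why it is not filed.
* §S5 the one language switch with teeth — MOTIVATED ANCHORS: André's deformation theorem (tree
  named fact `Andre1996_deformation`, Thm. 0.5) makes the variational principle a THEOREM for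
  motivated classes, so `HodgeIsMotivatedAll` is implied by a pure anchor-existence statement
  `MotivatedAnchorExistence` (`hodgeIsMotivatedAll_of_anchors`, sorry-free modulo that fact, using
  the tree theorem `map_mem_motivatedClasses_of_iso`). Composed: `B ∧ anchors ⊢ SectorComplement`,
  Σ unused (`sectorComplement_of_anchors`) — i.e. the summit card `motivated-anchor-transport`
  seen through this frame.
* §N9 the negation object of this pass: `RigidHodgePointsAlgebraic` (isolated points of the
  Hodge locus of a `ℚ̄`-family are `ℚ̄`-points = the SPECIAL-POINT case of Klingler–Otwinowska–Urbanik,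
  Ann. Sci. ÉNS 56 (2023), arXiv:2010.03359, Conj. 1.5(a), to which their Cor. 1.14 reduces the whole
  field-of-definition conjecture) — typed over the tree's `HodgeLocusComponent` / `IsBaseDefinedOverQbar`;
  HC-implied on paper (relative Chow schemes over `ℚ̄`), strictly weaker, and the shape of the cheapest
  falsifier of the SUMMIT this seat can name; it does not touch the step `Σ → HC`.

(The zero-seat wiring splits onto other routes' items — AnchorTransport, QbarEnvelope,
ConservativityLefschetz, … — are kernel-checked in the parallel seat's `StrategyCensus13684s1.lean` §2
and are not repeated here.) Everything is sorry-free. Nothing here asserts a Theses decl.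
-/

set_option linter.dupNamespace false

namespace Summit.HodgeConjecture.HodgeConjecture.Cruxes.SectorComplement.StrategyCensus.NikulinTwinTransport.P1

open Summit.HodgeConjecture.HodgeConjecture.Theses.NikulinTwinTransport
open Summit.HodgeConjecture.HodgeConjecture.Theorems
open Literature.AlgebraicGeometry.HodgeTheory Literature.AlgebraicGeometry.Motives
open CategoryTheory MonoidalCategory

/-! ## §D2′ The fact-free André seam — the fileable split and its residual laws -/

/-- Child 1, `MotivatedAlgebraicAll`: on every smooth projective complex variety every motivated
class (André 1996, Déf. 1, real carriers `motivatedClasses`) is algebraic. On paper this is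
EQUIVALENT to Grothendieck's standard conjecture of Lefschetz type for all varieties (⇐: André 1996
§2.1 remark after Déf. 1 = the tree's named fact; ⇒: `*_L` and the Künneth projectors are motivated
correspondences, André 1996 Prop. 2.2), hence HC-implied on paper (motivated classes are Hodge
classes) and believed strictly weaker than HC. Known: curves, surfaces, abelian varieties
(Lieberman 1968), generalised flag varieties, HK of `K3^[n]` type (Charles–Markman 2013).
[cite: Andre1996Motifs, §2.1 remark after Déf. 1 and Prop. 2.2] [cite: Kleiman1968, §2] -/
def MotivatedAlgebraicAll : Prop :=
  ∀ ⦃n : ℕ⦄ ⦃X : SchemeOver ℂ⦄, IsSmoothProjective n X → ∀ p : ℕ,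
    motivatedClasses n X p ≤ algebraicClasses X p

/-- Child 2, `HodgeIsMotivatedAll` (verbatim generation 0's decl): every rational `(p,p)` class on
every smooth projective complex variety is motivated. A THEOREM on abelian varieties (André 1996
Thm. 0.6.2 = tree fact `Andre1996_hodgeClasses_abelianVariety_motivated`) where HC is open from
Weil sixfolds on — the evidence that this child is strictly weaker than the summit in kind.
[cite: Andre1996Motifs, Thm. 0.6.2 and §0.4] -/
def HodgeIsMotivatedAll : Prop :=
  ∀ ⦃n : ℕ⦄ ⦃X : SchemeOver ℂ⦄, IsSmoothProjective n X → ∀ (p : ℕ) (c : complexBetti X (2 * p)),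
    IsRationalClass c → IsOfHodgeType n X (2 * p) p p c → c ∈ motivatedClasses n X p

/-- The two children close the SUMMIT, with no named fact and no sector: Hodge ⊆ motivated ⊆
algebraic, Hodge models by the tree theorem `nonempty_hodgeModel_holds`. [cite: Andre1996Motifs, §0.4] -/
theorem hodgeConjecture_of_subs (h₁ : MotivatedAlgebraicAll) (h₂ : HodgeIsMotivatedAll) :
    _root_.HodgeConjecture :=
  fun _ _ hX ↦ ⟨nonempty_hodgeModel_holds hX, fun p c hc hpp ↦ h₁ hX p (h₂ hX p c hc hpp)⟩

/-- THE WOULD-BE SPLIT GLUE (`<CruxDecl>_of_subs` of the strategist protocol (b)):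
`MotivatedAlgebraicAll → HodgeIsMotivatedAll → SectorComplement`, sorry-free, hypothesis-free —
and the sector `Σ = SquareHodgeOfSqrtTwo` is discarded (`fun _ ↦`): the split is a decomposition
of the summit, not of the step `Σ → HC`. [cite: Andre1996Motifs, §0.4] -/
theorem sectorComplement_of_subs (h₁ : MotivatedAlgebraicAll) (h₂ : HodgeIsMotivatedAll) :
    SectorComplement :=
  fun _ ↦ hodgeConjecture_of_subs h₁ h₂

/-- Child 1 is exactly what the tree's André fact delivers from `B` for all varieties.
[cite: Andre1996Motifs, §2.1 remark after Déf. 1] -/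
theorem motivatedAlgebraicAll_of_standardConjectureB
    (hA : Andre1996_motivatedClasses_le_algebraicClasses_of_standardConjectureB)
    (hB : ∀ (d : ℕ) (Z : SchemeOver ℂ) (η : complexBetti Z 2), IsSmoothProjective d Z →
      StandardConjectureBStar d Z η) :
    MotivatedAlgebraicAll :=
  fun _ _ hX p ↦ hA hB hX p

/-- Child 2 is HC-implied UNCONDITIONALLY in the tree (algebraic ⊆ motivated, hard Lefschetz datum of
`X ⊗ X` by `nonempty_hardLefschetzNFold_holds`). [cite: Andre1996Motifs, §2.1 remark after Déf. 1] -/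
theorem hodgeIsMotivatedAll_of_hodgeConjecture (h : _root_.HodgeConjecture) : HodgeIsMotivatedAll :=
  fun _ _ hX p c hc hpp ↦
    algebraicClasses_le_motivatedClasses_of_nonempty_hardLefschetzNFold hX
      (nonempty_hardLefschetzNFold_holds _ _) p ((h hX).2 p c hc hpp)

/-- Residual law 1: GIVEN child 1, child 2 is the summit. [folklore] -/
theorem hodgeIsMotivatedAll_iff_hodgeConjecture_of_child₁ (h₁ : MotivatedAlgebraicAll) :
    HodgeIsMotivatedAll ↔ _root_.HodgeConjecture :=
  ⟨hodgeConjecture_of_subs h₁, hodgeIsMotivatedAll_of_hodgeConjecture⟩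

/-- Residual law 2: GIVEN child 1 and the sector, child 2 is the crux (and conversely the crux plus
the sector give child 2). So the split has a proper residual only to the extent child 1 (`B`) is
open — the honest content division "explicit cycle for `*_L`" / "everything transcendental".
[folklore] -/
theorem hodgeIsMotivatedAll_iff_sectorComplement_of_child₁ (h₁ : MotivatedAlgebraicAll)
    (hSig : SquareHodgeOfSqrtTwo) : HodgeIsMotivatedAll ↔ SectorComplement :=
  (hodgeIsMotivatedAll_iff_hodgeConjecture_of_child₁ h₁).trans
    (nikulinTwinTransport_sectorComplement_iff_hodgeConjecture hSig).symm

/-- Neither child is USED by the sector and the sector is used by neither: the only typed relation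
between `Σ` and the children runs through the summit (`HC → Σ`, p84060). Recorded as the
implication the census calls "Σ inert". [folklore] -/
theorem sigma_of_subs (h₁ : MotivatedAlgebraicAll) (h₂ : HodgeIsMotivatedAll) : SquareHodgeOfSqrtTwo :=
  nikulinTwinTransport_squareHodgeOfSqrtTwo_of_hodgeConjecture (hodgeConjecture_of_subs h₁ h₂)

/-! ## §S5 Motivated anchors: the switch with teeth (André's deformation theorem) -/

/-- `MotivatedAnchorExistence`: every rational `(p,p)` class `c` on a smooth projective `X` of
dimension `n` is, up to an isomorphism `e : X ≅ 𝒳_{s₁}`, the restriction of a GLOBAL class `A` on the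
total space of a smooth projective family `f : 𝒳 ⟶ S` (projective in Hartshorne's sense, over a
reduced connected base of finite type — exactly the hypotheses of the tree's `Andre1996_deformation`)
some fibre restriction `A|_{𝒳_{s₀}}` of which is MOTIVATED. The motivated analogue of
`AnchorTransport.AnchorExistence` (algebraic anchor) — but here the companion transport statement is
not a crux: it is André's Thm. 0.5. No fibrewise Hodge condition is needed (a flat class motivated at
one fibre is motivated, hence Hodge, at all fibres). [cite: Andre1996Motifs, Thm. 0.5 (p. 8) and §5.1] -/
def MotivatedAnchorExistence : Prop :=
  ∀ ⦃n : ℕ⦄ ⦃X : SchemeOver ℂ⦄, IsSmoothProjective n X → ∀ (p : ℕ) (c : complexBetti X (2 * p)),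
    IsRationalClass c → IsOfHodgeType n X (2 * p) p p c →
    ∃ (𝒳 S : SchemeOver ℂ) (f : 𝒳 ⟶ S) (s₁ s₀ : ComplexPoints S) (e : X ≅ fiberOver f s₁)
      (A : complexBetti 𝒳 (2 * p)),
      IsSmoothProjectiveFamily f n ∧
      (∃ (N : ℕ) (ι : 𝒳 ⟶ Literature.AlgebraicGeometry.Motives.projectiveSpace N ℂ ⊗ S),
          AlgebraicGeometry.IsClosedImmersion ι.left ∧
            ι ≫ SemiCartesianMonoidalCategory.snd
              (Literature.AlgebraicGeometry.Motives.projectiveSpace N ℂ) S = f) ∧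
      AlgebraicGeometry.IsReduced S.left ∧ ConnectedSpace S.left ∧
      AlgebraicGeometry.LocallyOfFiniteType S.hom ∧ AlgebraicGeometry.QuasiCompact S.hom ∧
      complexBetti.map e.hom (2 * p) (complexBetti.map (fiberι f s₁) (2 * p) A) = c ∧
      complexBetti.map (fiberι f s₀) (2 * p) A ∈ motivatedClasses n (fiberOver f s₀) p

/-- THE TEETH: modulo André's deformation theorem (named fact, Thm. 0.5), motivated anchors give
"every Hodge class is motivated" — transport along the family is free, and the isomorphism `e` is
absorbed by the tree theorem `map_mem_motivatedClasses_of_iso`. [cite: Andre1996Motifs, Thm. 0.5 (p. 8)] -/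
theorem hodgeIsMotivatedAll_of_anchors (hD : Andre1996_deformation) (h : MotivatedAnchorExistence) :
    HodgeIsMotivatedAll := by
  intro n X hX p c hc hpp
  obtain ⟨𝒳, S, f, s₁, s₀, e, A, hf, hι, hred, hconn, hft, hqc, hce, hs₀⟩ := h hX p c hc hpp
  have h₁ : complexBetti.map (fiberι f s₁) (2 * p) A ∈ motivatedClasses n (fiberOver f s₁) p :=
    hD f hf hι hred hconn hft hqc p A s₀ hs₀ s₁
  rw [← hce]
  exact map_mem_motivatedClasses_of_iso (hf.isSmoothProjective s₁) hX e h₁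

/-- The switch composed through the frame: `B` for all varieties ∧ motivated anchors ⊢ the crux,
modulo the two André facts — with `Σ` unused. This is the summit card `motivated-anchor-transport`
(its C1 = anchors, C2 = `B`), not a line on the step `Σ → HC`. [cite: Andre1996Motifs, Thm. 0.5 and §0.4] -/
theorem sectorComplement_of_anchors
    (hA : Andre1996_motivatedClasses_le_algebraicClasses_of_standardConjectureB)
    (hD : Andre1996_deformation)
    (hB : ∀ (d : ℕ) (Z : SchemeOver ℂ) (η : complexBetti Z 2), IsSmoothProjective d Z →
      StandardConjectureBStar d Z η)
    (h : MotivatedAnchorExistence) : SectorComplement :=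
  sectorComplement_of_subs (motivatedAlgebraicAll_of_standardConjectureB hA hB)
    (hodgeIsMotivatedAll_of_anchors hD h)

/-- Where the teeth stop biting: on a RIGID class (one whose every admissible family has all its
motivated fibres isomorphic to `X` itself — informally, an isolated point of its Hodge locus) the
anchor statement asks for the class to be motivated on the nose. Typed as the trivial instance of the
anchor shape: an anchor with `s₀ = s₁` IS the conclusion. [folklore] -/
theorem mem_motivatedClasses_of_selfAnchor {n p : ℕ} {X 𝒳 S : SchemeOver ℂ} {f : 𝒳 ⟶ S}
    (hX : IsSmoothProjective n X) (hf : IsSmoothProjectiveFamily f n) (s : ComplexPoints S)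
    (e : X ≅ fiberOver f s) (A : complexBetti 𝒳 (2 * p))
    (hs : complexBetti.map (fiberι f s) (2 * p) A ∈ motivatedClasses n (fiberOver f s) p) :
    complexBetti.map e.hom (2 * p) (complexBetti.map (fiberι f s) (2 * p) A) ∈ motivatedClasses n X p :=
  map_mem_motivatedClasses_of_iso (hf.isSmoothProjective s) hX e hs

/-! ## §N9 The negation object: rigid Hodge points of `ℚ̄`-families -/

/-- `RigidHodgePointsAlgebraic`: for a smooth projective family `f₀ : 𝒳₀ ⟶ S₀` DEFINED OVER `ℚ̄`
(complexified along `σ : ℚ̄ →+* ℂ`), every component of the locus of Hodge classes whose base is a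
single point `{t}` has that base defined over `ℚ̄` — i.e. isolated Hodge points are `ℚ̄`-points
(the tree's `HodgeLocusComponent`, `IsBaseDefinedOverQbar`). On paper HC-implied (an algebraic
cycle at `X_t` lives in the relative Chow scheme of `𝒳₀/S₀`, defined over `ℚ̄`; the image of its
component is a `ℚ̄`-subvariety of `S₀` through `t` along which the class stays algebraic, hence
Hodge, hence `⊆ {t}`); the dimension-0 case of Voisin 2007 Thm. 0.5 (2) / Lemma 1.4. Calibrations
where it is a THEOREM: weight 2 (Noether–Lefschetz points of a `ℚ̄`-pencil of surfaces are
`ℚ̄`-points, by Lefschetz (1,1)); pencils of cubic fourfolds (HC known, Zucker 1977). Open where HC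
is: the first hypersurface habitat is degree ≥ 6 in `ℙ⁵` (`h^{3,1} ≥ 426`). A certified
transcendental isolated Hodge point would refute the summit; the census records why none is
computable today. [cite: Voisin2007HodgeLoci, Thm. 0.5 (2) and Lemma 1.4]
[cite: CattaniDeligneKaplan1995, Cor. 1.2] -/
def RigidHodgePointsAlgebraic : Prop :=
  ∀ (σ : AlgebraicClosure ℚ →+* ℂ) ⦃𝒳₀ S₀ : SchemeOver (AlgebraicClosure ℚ)⦄ (f₀ : 𝒳₀ ⟶ S₀)
    (n p : ℕ), IsSmoothProjectiveFamily ((baseChangeHom σ).map f₀) n →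
    ∀ (C : HodgeLocusComponent ((baseChangeHom σ).map f₀) n p)
      (t : ComplexPoints ((baseChangeHom σ).obj S₀)), C.base = {t} → C.IsBaseDefinedOverQbar

/-- A transcendental rigid Hodge point refutes the SUMMIT, granted the paper implication
`HC → RigidHodgePointsAlgebraic` (relative Chow schemes over `ℚ̄`; not derivable in the tree, hence a
hypothesis). [cite: Voisin2007HodgeLoci, Lemma 1.4] -/
theorem not_hodgeConjecture_of_transcendental_rigidPoint
    (hImp : _root_.HodgeConjecture → RigidHodgePointsAlgebraic) (hT : ¬ RigidHodgePointsAlgebraic) :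
    ¬ _root_.HodgeConjecture :=
  fun h ↦ hT (hImp h)

/-- … and it settles nothing about THIS crux unless the sector is proved as well: with `¬HC` in hand,
`SectorComplement ↔ ¬Σ` (the frame law of p84060). A refutation of the crux is `Σ ∧ ¬HC`, i.e. the
route's own open programme plus a counterexample to the summit. [folklore] -/
theorem sectorComplement_iff_not_sigma_of_not_hodgeConjecture (h : ¬ _root_.HodgeConjecture) :
    SectorComplement ↔ ¬ SquareHodgeOfSqrtTwo :=
  ⟨fun hSC hSig ↦ h (hSC hSig), fun hn hSig ↦ absurd hSig hn⟩

end Summit.HodgeConjecture.HodgeConjecture.Cruxes.SectorComplement.StrategyCensus.NikulinTwinTransport.P1
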